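import Literature.NumberTheory.EllipticCurves.KatoAdditiveTwistedValueNeronIntegralityThree
import Summits.BirchSwinnertonDyer.BirchSwinnertonDyer.Theorems.ManinLocalTwoThreeKatoShiftPrimeClassLattice
import Summits.BirchSwinnertonDyer.BirchSwinnertonDyer.Theorems.ManinLocalTwoThreeKatoShiftHoleOrthogonality
import Summits.BirchSwinnertonDyer.BirchSwinnertonDyer.Theorems.ManinLocalTwoThreeKatoShiftAdmissibleCharacters

/-!
# Route `ManinLocalTwoThree`, crux C3 `ManinPrimeToThreeAtNine` (stmt-BirchSwinnertonDyer-22968), line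
# `kato-shift-three` (es g6): the Euler-system step `stub_three_dvd_shiftClass` — GRANTED the `p = 3` Kato
# fact, at a lattice-optimal datum with `3 ∣ c` every shift class `{a/ℓ, 3a/ℓ}_f` over an admissible `ℓ`
# has imaginary part in `3ℤ·(Ω⁻_f/2)` (line prover p1; helper)

Assembly of the tree fact `kato_neron_isIntegral_twistedSymbolSum_of_additive_three_polar` (hypothesis
`hK`, statement-only, Kato 2004 + Kosters–Pannekoek read in Néron units; cell bsd-f2-manin F-es-18) with
the three helper files of this seat:
`…KatoShiftPrimeClassLattice` (prime classes are periods; lattice coordinates `y(a) ∈ ℤ`, odd;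
`Σ_a χ(a){∞,a/ℓ} = i(Ω⁻_f/2)·Σ_a χ(a) y(a)` for odd `χ`), `…KatoShiftAdmissibleCharacters` (binders of the
fact and Euler `3`-units for admissible `ℓ ≡ 11 (mod 12)`), `…KatoShiftHoleOrthogonality` (inversion over
the odd characters with `χ(3) ≠ 1` ⟹ `3 ∣ y(3a) − y(a)`).

* `pint_charSum_div_three` — for ONE odd `χ` mod `ℓ` with `χ(3) ≠ 1`: `(Σ_a χ(a) y(a))/3` is `3`-integral,
  from the fact at the lattice-optimal datum (`ϖ = m₀/|c|`, `m₀ ∣ 2`, tree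
  `SkinnerUrban2014.exists_dvd_two_mul_imaginaryPeriodRat_eq_of_latticeEq`) and `3 ∣ c`.
* `three_dvd_latticeCoord_shift` / `exists_int_im_shiftClass_eq_three_mul` — **the stub's conclusion**:
  `Im({0,3a/ℓ}_f − {0,a/ℓ}_f) = 3n·(Ω⁻_f/2)`, for every admissible `ℓ` (`ℓ ∤ N` prime, `ℓ ≡ 11 (mod 12)`,
  Legendre conditions `(q/ℓ) = ε_q` at the `q ∥ N`) and `0 < a < ℓ`; hypotheses as in the line's
  `stub_three_dvd_shiftClass` plus `a_q ∈ {1, −1}` at the `q ∥ N` of the LEVEL (print: Atkin–Lehner Thm. 3;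
  in the line this is where `N` = conductor enters).

Nothing about BSD is proved here; Manin's conjecture at `3` is NOT proved here (the line still needs the
shift-generation law E-es-19 and the reducible residual).
-/

set_option autoImplicit false
set_option linter.dupNamespace false

noncomputable section

open scoped Classical MatrixGroups ModularForm

open CongruenceSubgroup Complex Literature.NumberTheory.EllipticCurves
  Literature.NumberTheory.EllipticCurves.ModularForms
  Summit.BirchSwinnertonDyer.BirchSwinnertonDyer.Theorems.ManinFrameResidueProperRTameTwist

namespace Summit.BirchSwinnertonDyer.BirchSwinnertonDyer.Theorems.ManinLocalTwoThree

section Shift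

variable {W : WeierstrassCurve ℚ} [W.IsElliptic] [W.IsGloballyMinimal] {N : ℕ} [NeZero N]

omit [W.IsElliptic] [W.IsGloballyMinimal] in
/-- **Lattice coordinates of the prime classes.** For the newform `f` of a datum and a prime `ℓ ∤ N`
there is an ODD integer-valued `y` on `ℤ/ℓ` with `Im({∞, x̃/ℓ}_f − {∞,0}_f) = y(x)·(Ω⁻_f/2)`.
[cite: Manin1972, Prop. 1.4 / Thm. 1.6] [cite: CremonaAlgorithms1997, §2.8] -/
theorem exists_latticeCoord (D : ModularParametrizationData W N) {ℓ : ℕ} (hℓ : ℓ.Prime)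
    (hℓN : ¬ ℓ ∣ N) :
    ∃ y : ZMod ℓ → ℤ,
      (∀ x : ZMod ℓ, (modularSymbol D.f (((x.val : ℕ) : ℚ) / ℓ) - modularSymbol D.f 0).im =
        y x * (minusPeriod D.f / 2)) ∧ (∀ x : ZMod ℓ, y (-x) = -y x) := by
  haveI : NeZero ℓ := ⟨hℓ.ne_zero⟩
  have hreal : ∀ n, (cuspCoeff D.f n).im = 0 :=
    cuspCoeff_im_eq_zero_of_coeffField_eq_bot D.isNewformOf.coeffField_eq_bot
  have hΩf : 0 < minusPeriod D.f :=
    IsNewform0.minusPeriod_pos_holds D.isNewformOf.1 D.isNewformOf.coeffField_eq_bot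
  have hex : ∀ x : ZMod ℓ, ∃ n : ℤ,
      (modularSymbol D.f (((x.val : ℕ) : ℚ) / ℓ) - modularSymbol D.f 0).im =
        n * (minusPeriod D.f / 2) := by
    intro x
    by_cases hx : x = 0
    · refine ⟨0, ?_⟩
      subst hx
      simp [ZMod.val_zero]
    · exact exists_int_im_primeClassZMod D.f hℓ hℓN hΩf x hx
  choose y hy using hex
  refine ⟨y, hy, fun x ↦ ?_⟩
  have h := im_primeClassZMod_neg D.f hℓ.ne_zero hreal x
  rw [hy, hy] at h
  have hne : minusPeriod D.f / 2 ≠ 0 := by positivity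
  have h' : ((y (-x) : ℝ)) * (minusPeriod D.f / 2) = (-(y x : ℝ)) * (minusPeriod D.f / 2) := by
    rw [h]; ring
  have : ((y (-x) : ℝ)) = -(y x : ℝ) := mul_right_cancel₀ hne h'
  exact_mod_cast this

/-- **The Legendre condition of an admissible prime, unpacked**: `(q/ℓ) = ε_q` with
`ε_q = −1` iff `q·a_q ≡ 1 (mod 3)` says: `q·a_q ≡ 1 (mod 3)` ⟹ `q` is a non-residue mod `ℓ`, and
otherwise `q` is a residue. [folklore] -/
theorem legendre_condition_of_jacobiSym {ℓ : ℕ} (hℓ : ℓ.Prime) {q : ℕ} (hq : q.Prime) (hqℓ : q ≠ ℓ)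
    (a : ℤ) (h : jacobiSym (q : ℤ) ℓ = (if ((q : ℤ) * a) % 3 = 1 then -1 else 1)) :
    ((3 : ℤ) ∣ (q : ℤ) * a - 1 → ¬ IsSquare ((q : ℕ) : ZMod ℓ)) ∧
      (¬ (3 : ℤ) ∣ (q : ℤ) * a - 1 → IsSquare ((q : ℕ) : ZMod ℓ)) := by
  haveI : Fact ℓ.Prime := ⟨hℓ⟩
  have hq0 : ((q : ℤ) : ZMod ℓ) ≠ 0 := by
    rw [Int.cast_natCast, Ne, ZMod.natCast_eq_zero_iff]
    intro hd
    exact hqℓ ((Nat.prime_dvd_prime_iff_eq hℓ hq).mp hd).symm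
  have hmod : ((q : ℤ) * a) % 3 = 1 ↔ (3 : ℤ) ∣ (q : ℤ) * a - 1 := by
    constructor
    · intro h1
      have := Int.emod_emod_of_dvd ((q : ℤ) * a) (dvd_refl (3 : ℤ))
      omega
    · intro h1
      omega
  rw [← jacobiSym.legendreSym.to_jacobiSym] at h
  constructor
  · intro h3
    rw [if_pos (hmod.mpr h3)] at h
    have := (legendreSym.eq_neg_one_iff ℓ).mp h
    rwa [Int.cast_natCast] at this
  · intro h3
    rw [if_neg (fun h1 ↦ h3 (hmod.mp h1))] at h
    have := (legendreSym.eq_one_iff ℓ hq0).mp h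
    rwa [Int.cast_natCast] at this

/-- **One odd character with `χ(3) ≠ 1`: `(Σ_a χ(a) y(a))/3` is `3`-integral**, GRANTED the `p = 3` Kato
fact, at a lattice-optimal datum of a curve additive at `3` with `W[3]` irreducible and `3 ∣ c`, for an
admissible `ℓ` (prime, `ℓ ∤ N`, `ℓ ≡ 11 (mod 12)`, Legendre conditions at the `q ∥ N` with `a_q = ±1`).
Chain: the fact gives `s·ϖ·r ∈ ℤ̄` (`3 ∤ s`) with `ϖ = m₀/|c|`, `m₀ ∣ 2`, and
`E(χ)·Σ_a χ(a){∞,a/ℓ} = r·Ω⁻_f·i`; by `Σ_a χ(a){∞,a/ℓ} = i(Ω⁻_f/2)·A` this reads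
`s·m₀·E(χ)·A/(2|c|) ∈ ℤ̄`; with `|c| = 3|c'|`, `s m₀ · E(χ)·(A/3) ∈ ℤ̄`, and `E(χ)` is a `3`-unit.
[cite: Kato2004Asterisque, Thm. 9.7 (p. 189)] [cite: KostersPannekoek2017, Thm. 1 (ii)] -/
theorem pint_charSum_div_three (hK : kato_neron_isIntegral_twistedSymbolSum_of_additive_three_polar)
    (D : ModularParametrizationData W N)
    (hopt : ∀ z ∈ D.L.lattice, ∃ w ∈ periodLattice D.f, z = D.c * w)
    (hadd : ¬ W.HasGoodReductionAtPrime 3 ∧ ¬ W.HasMultiplicativeReductionAtPrime 3)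
    (hirr : W.HasIrreducibleModPGaloisRep 3) (h3c : (3 : ℤ) ∣ D.c) (h9 : 3 ^ 2 ∣ N)
    (ha : ∀ q ∈ N.primeFactors, ¬ q ^ 2 ∣ N → W.LFunction q = 1 ∨ W.LFunction q = -1)
    {ℓ : ℕ} (hℓ : ℓ.Prime) (hℓN : ¬ ℓ ∣ N) (h12 : ℓ % 12 = 11)
    (hL : ∀ q ∈ N.primeFactors, ¬ q ^ 2 ∣ N →
      jacobiSym (q : ℤ) ℓ = (if ((q : ℤ) * W.LFunction q) % 3 = 1 then -1 else 1))
    {y : ZMod ℓ → ℤ}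
    (hy : ∀ x : ZMod ℓ, (modularSymbol D.f (((x.val : ℕ) : ℚ) / ℓ) - modularSymbol D.f 0).im =
      y x * (minusPeriod D.f / 2))
    (χ : DirichletCharacter ℂ ℓ) (hχ : χ.Odd) (hχ3 : χ (3 : ZMod ℓ) ≠ 1) :
    haveI : NeZero ℓ := ⟨hℓ.ne_zero⟩
    ∃ s : ℕ, ¬ 3 ∣ s ∧ IsIntegral ℤ ((s : ℂ) * ((∑ a : ZMod ℓ, χ a * (y a : ℂ)) / (3 : ℕ))) := by
  haveI : NeZero ℓ := ⟨hℓ.ne_zero⟩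
  haveI : Fact ℓ.Prime := ⟨hℓ⟩
  obtain ⟨-, -, h3ℓ1, -, hℓ3, -⟩ := mod_twelve_facts (ℓ := ℓ) h12
  have hreal : ∀ n, (cuspCoeff D.f n).im = 0 :=
    cuspCoeff_im_eq_zero_of_coeffField_eq_bot D.isNewformOf.coeffField_eq_bot
  have hΩf : 0 < minusPeriod D.f :=
    IsNewform0.minusPeriod_pos_holds D.isNewformOf.1 D.isNewformOf.coeffField_eq_bot
  have hΩ : 0 < W.imaginaryPeriodRat := W.imaginaryPeriodRat_pos
  have hc0 : D.c ≠ 0 := D.maninConstant_ne_zero_holds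
  -- the period scalar `ϖ = m₀/|c|`
  obtain ⟨mm, hmm2, hmm⟩ := SkinnerUrban2014.exists_dvd_two_mul_imaginaryPeriodRat_eq_of_latticeEq D hopt
  set cabs : ℤ := |D.c| with hcabs
  have hcabs0 : cabs ≠ 0 := abs_ne_zero.mpr hc0
  set ϖ : ℚ := (mm : ℚ) / (cabs : ℚ) with hϖdef
  have habs0 : |(D.c : ℝ)| ≠ 0 := abs_ne_zero.mpr (by exact_mod_cast hc0)
  have hcabsR : ((cabs : ℤ) : ℝ) = |(D.c : ℝ)| := by rw [hcabs, Int.cast_abs]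
  have hϖ : (ϖ : ℝ) * W.imaginaryPeriodRat = minusPeriod D.f := by
    rw [hϖdef]; push_cast
    rw [hcabsR, div_mul_eq_mul_div, hmm]
    field_simp
  -- the symmetrised Euler factor and the twisted value
  set A : ℂ := ∑ a : ZMod ℓ, χ a * (y a : ℂ) with hAdef
  set E : ℂ := ∏ q ∈ N.primeFactors with ¬ q ^ 2 ∣ N,
      (((q : ℂ) - (W.LFunction q : ℂ) * χ (q : ZMod ℓ)) *
        ((q : ℂ) - (W.LFunction q : ℂ) * (χ (q : ZMod ℓ))⁻¹)) with hEdef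
  set T : ℂ := twistedSymbolSum D.f χ with hTdef
  have hT : T = I * (((minusPeriod D.f / 2 : ℝ) : ℂ) * A) := by
    have hpt : ∀ x : ZMod ℓ, χ x *
        (((modularSymbol D.f (((x.val : ℕ) : ℚ) / ℓ) - modularSymbol D.f 0).im : ℝ) : ℂ) =
        ((minusPeriod D.f / 2 : ℝ) : ℂ) * (χ x * (y x : ℂ)) := by
      intro x; rw [hy x]; push_cast; ring
    rw [hTdef, twistedSymbolSum_eq_I_mul_sum D.f hℓ.ne_zero hreal χ hχ,
      Finset.sum_congr rfl (fun x _ ↦ hpt x), ← Finset.mul_sum]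
  set r : ℂ := E * T / (((minusPeriod D.f : ℝ) : ℂ) * I) with hrdef
  have hden : ((minusPeriod D.f : ℝ) : ℂ) * I ≠ 0 :=
    mul_ne_zero (by exact_mod_cast hΩf.ne') I_ne_zero
  have hval : E * T = r * (minusPeriod D.f : ℂ) * Complex.I := by
    rw [hrdef, mul_assoc, div_mul_cancel₀ _ hden]
  -- the fact
  have hm : ℓ.Coprime (3 * N) := Nat.Coprime.mul_right
    ((Nat.coprime_primes hℓ Nat.prime_three).mpr hℓ3) ((hℓ.coprime_iff_not_dvd).mpr hℓN)
  obtain ⟨s, hs, hint⟩ := (hK W D.f D.isNewformOf hadd.1 hadd.2 hirr ℓ hm χ (isPrimitive_of_odd hχ)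
    (ne_one_of_odd hχ) (not_three_dvd_orderOf h12 χ) hχ3 (apply_three_ne_neg_one h12 χ) ϖ r).2
    hχ hϖ hval
  -- `ϖ r = (m₀/(2|c|)) · E · A`
  have hcabsC : ((cabs : ℤ) : ℂ) ≠ 0 := by exact_mod_cast hcabs0
  have hϖC : (ϖ : ℂ) = (mm : ℂ) / ((cabs : ℤ) : ℂ) := by rw [hϖdef]; push_cast; rfl
  have hϖr : (ϖ : ℂ) * r = ((mm : ℂ) / (2 * ((cabs : ℤ) : ℂ))) * (E * A) := by
    rw [hrdef, hT, hϖC]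
    have hΩ0 : ((minusPeriod D.f : ℝ) : ℂ) ≠ 0 := by exact_mod_cast hΩf.ne'
    have h2 : ((minusPeriod D.f / 2 : ℝ) : ℂ) = ((minusPeriod D.f : ℝ) : ℂ) / 2 := by push_cast; rfl
    rw [h2]
    field_simp
  -- `|c| = 3 |c'|`
  obtain ⟨c', hc'⟩ := h3c
  have habs : cabs = 3 * |c'| := by
    rw [hcabs, hc', abs_mul]; norm_num
  have hc'0 : c' ≠ 0 := by rintro rfl; exact hc0 (by rw [hc', mul_zero])
  -- `s m₀ · E · (A/3)` is integral: multiply `s ϖ r` by `2|c'| ∈ ℤ`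
  have hkey : (((2 * |c'| : ℤ)) : ℂ) * ((s : ℂ) * (ϖ : ℂ) * r) =
      ((s * mm : ℕ) : ℂ) * (E * (A / (3 : ℕ))) := by
    rw [mul_assoc (s : ℂ), hϖr, habs]
    have habs' : ((|c'| : ℤ) : ℂ) ≠ 0 := by exact_mod_cast (abs_ne_zero.mpr hc'0)
    push_cast
    field_simp
  have hint2 : IsIntegral ℤ (((s * mm : ℕ) : ℂ) * (E * (A / (3 : ℕ)))) := by
    rw [← hkey]
    exact (isIntegral_algebraMap (R := ℤ) (x := (2 * |c'| : ℤ))).mul (by simpa [mul_assoc] using hint)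
  have hsmm : ¬ 3 ∣ s * mm := by
    intro h
    rcases (Nat.Prime.dvd_mul Nat.prime_three).mp h with h1 | h2
    · exact hs h1
    · have : mm ≤ 2 := Nat.le_of_dvd two_pos hmm2
      interval_cases mm <;> omega
  have hpintEA : ∃ s : ℕ, ¬ 3 ∣ s ∧ IsIntegral ℤ ((s : ℂ) * (E * (A / (3 : ℕ)))) := ⟨s * mm, hsmm, hint2⟩
  -- cancel the `3`-unit `E`
  have hℓN' : ¬ ℓ ∣ N := hℓN
  have h3q : ∀ q ∈ N.primeFactors, ¬ q ^ 2 ∣ N → q ≠ 3 := by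
    rintro q hq hq2 rfl; exact hq2 h9
  have hLsq : ∀ q ∈ N.primeFactors, ¬ q ^ 2 ∣ N →
      ((3 : ℤ) ∣ (q : ℤ) * W.LFunction q - 1 → ¬ IsSquare ((q : ℕ) : ZMod ℓ)) ∧
        (¬ (3 : ℤ) ∣ (q : ℤ) * W.LFunction q - 1 → IsSquare ((q : ℕ) : ZMod ℓ)) := by
    intro q hq hq2
    have hqp : q.Prime := Nat.prime_of_mem_primeFactors hq
    have hqℓ : q ≠ ℓ := by rintro rfl; exact hℓN (Nat.dvd_of_mem_primeFactors hq)
    exact legendre_condition_of_jacobiSym hℓ hqp hqℓ _ (hL q hq hq2)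
  obtain ⟨w, t, hw, hEw, ht⟩ := exists_symmEuler_prod_mul_eq_three (ℓ := ℓ) h12 (N := N)
    (fun q ↦ W.LFunction q) ha h3q hℓN' hχ hLsq
  have ht' : ¬ ((3 : ℕ) : ℤ) ∣ t := ht
  exact pint_of_pint_mul_of_mul_eq Nat.prime_three hw hEw ht' hpintEA

/-- **The shift congruence in lattice coordinates** (`stub_three_dvd_shiftClass`, coordinates form):
under the hypotheses of `pint_charSum_div_three` (for all odd `χ` with `χ(3) ≠ 1` at once) the odd
lattice coordinate `y` satisfies `3 ∣ y(3x) − y(x)` for every unit `x` mod `ℓ` — by the hole orthogonality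
(`dvd_sub_of_hole` at `u = 3`, `p = 3`: `3 ∤ ℓ − 1`). [cite: Kato2004Asterisque, Thm. 9.7 (p. 189)] -/
theorem three_dvd_latticeCoord_shift
    (hK : kato_neron_isIntegral_twistedSymbolSum_of_additive_three_polar)
    (D : ModularParametrizationData W N)
    (hopt : ∀ z ∈ D.L.lattice, ∃ w ∈ periodLattice D.f, z = D.c * w)
    (hadd : ¬ W.HasGoodReductionAtPrime 3 ∧ ¬ W.HasMultiplicativeReductionAtPrime 3)
    (hirr : W.HasIrreducibleModPGaloisRep 3) (h3c : (3 : ℤ) ∣ D.c) (h9 : 3 ^ 2 ∣ N)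
    (ha : ∀ q ∈ N.primeFactors, ¬ q ^ 2 ∣ N → W.LFunction q = 1 ∨ W.LFunction q = -1)
    {ℓ : ℕ} (hℓ : ℓ.Prime) (hℓN : ¬ ℓ ∣ N) (h12 : ℓ % 12 = 11)
    (hL : ∀ q ∈ N.primeFactors, ¬ q ^ 2 ∣ N →
      jacobiSym (q : ℤ) ℓ = (if ((q : ℤ) * W.LFunction q) % 3 = 1 then -1 else 1))
    {y : ZMod ℓ → ℤ}
    (hy : ∀ x : ZMod ℓ, (modularSymbol D.f (((x.val : ℕ) : ℚ) / ℓ) - modularSymbol D.f 0).im =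
      y x * (minusPeriod D.f / 2))
    (hodd : ∀ x : ZMod ℓ, y (-x) = -y x) (β : (ZMod ℓ)ˣ) :
    (3 : ℤ) ∣ y (3 * (β : ZMod ℓ)) - y β := by
  haveI : NeZero ℓ := ⟨hℓ.ne_zero⟩
  haveI : Fact ℓ.Prime := ⟨hℓ⟩
  obtain ⟨-, -, h3ℓ1, -, hℓ3, -⟩ := mod_twelve_facts (ℓ := ℓ) h12
  -- the unit `3` of `ℤ/ℓ`
  have hcop : Nat.Coprime 3 ℓ := (Nat.coprime_primes Nat.prime_three hℓ).mpr hℓ3.symm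
  set u : (ZMod ℓ)ˣ := ZMod.unitOfCoprime 3 hcop with hu
  have hu3 : (u : ZMod ℓ) = 3 := by rw [hu, ZMod.coe_unitOfCoprime]; norm_num
  have hφ : ¬ 3 ∣ ℓ.totient := by rw [Nat.totient_prime hℓ]; exact h3ℓ1
  have hf : ¬ 3 ∣ orderOf u := by
    intro h
    apply hφ
    rw [← ZMod.card_units_eq_totient ℓ]
    exact h.trans (orderOf_dvd_card)
  have hA : ∀ χ : DirichletCharacter ℂ ℓ, χ.Odd → χ (u : ZMod ℓ) ≠ 1 →
      ∃ s : ℕ, ¬ 3 ∣ s ∧ IsIntegral ℤ ((s : ℂ) * ((∑ a : ZMod ℓ, χ a * (y a : ℂ)) / (3 : ℕ))) := by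
    intro χ hχ hχu
    rw [hu3] at hχu
    exact pint_charSum_div_three hK D hopt hadd hirr h3c h9 ha hℓ hℓN h12 hL hy χ hχ hχu
  have h := dvd_sub_of_hole (p := 3) Nat.prime_three y hodd u β hφ hf hA
  rwa [Units.val_mul, hu3] at h

/-- **`stub_three_dvd_shiftClass` of the line `kato-shift-three`, conclusion form** (admissibility and
the shift class spelled out; `IsLatticeOptimal` = the lattice clause): GRANTED the `p = 3` Kato fact, at a
lattice-optimal `X₀(N)`-datum `D` of a globally minimal `W` with `9 ∣ N`, `W` additive at `3`, `W[3]`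
irreducible and `3 ∣ c`, for every admissible prime `ℓ` (`ℓ ∤ N`, `ℓ ≡ 11 (mod 12)`, `(q/ℓ) = ε_q` at the
`q ∥ N`, where `a_q = ±1`) and every `0 < a < ℓ`:
`Im(({∞,3a/ℓ}_f − {∞,0}_f) − ({∞,a/ℓ}_f − {∞,0}_f)) = 3n·(Ω⁻_f/2)` for an integer `n`.
[cite: Kato2004Asterisque, Thm. 9.7 (p. 189)] [cite: KostersPannekoek2017, Thm. 1 (ii)]
[cite: MazurTateTeitelbaum1986, §I.8] -/
theorem exists_int_im_shiftClass_eq_three_mul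
    (hK : kato_neron_isIntegral_twistedSymbolSum_of_additive_three_polar)
    (D : ModularParametrizationData W N)
    (hopt : ∀ z ∈ D.L.lattice, ∃ w ∈ periodLattice D.f, z = D.c * w) (h9 : 3 ^ 2 ∣ N)
    (hadd : ¬ W.HasGoodReductionAtPrime 3 ∧ ¬ W.HasMultiplicativeReductionAtPrime 3)
    (hirr : W.HasIrreducibleModPGaloisRep 3) (h3c : (3 : ℤ) ∣ D.c)
    (ha : ∀ q ∈ N.primeFactors, ¬ q ^ 2 ∣ N → W.LFunction q = 1 ∨ W.LFunction q = -1)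
    {ℓ : ℕ} (hℓ : ℓ.Prime) (hℓN : ¬ ℓ ∣ N) (h12 : ℓ % 12 = 11)
    (hL : ∀ q ∈ N.primeFactors, ¬ q ^ 2 ∣ N →
      jacobiSym (q : ℤ) ℓ = (if ((q : ℤ) * W.LFunction q) % 3 = 1 then -1 else 1))
    (a : ℕ) (ha0 : 0 < a) (haℓ : a < ℓ) :
    ∃ n : ℤ, ((modularSymbol D.f (((3 * a : ℕ) : ℚ) / ℓ) - modularSymbol D.f 0) -
        (modularSymbol D.f ((a : ℚ) / ℓ) - modularSymbol D.f 0)).im = 3 * n * (minusPeriod D.f / 2) := by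
  haveI : NeZero ℓ := ⟨hℓ.ne_zero⟩
  haveI : Fact ℓ.Prime := ⟨hℓ⟩
  obtain ⟨y, hy, hodd⟩ := exists_latticeCoord D hℓ hℓN
  -- the unit `a` of `ℤ/ℓ`
  have hcop : Nat.Coprime a ℓ :=
    Nat.Coprime.symm ((Nat.Prime.coprime_iff_not_dvd hℓ).mpr (Nat.not_dvd_of_pos_of_lt ha0 haℓ))
  set β : (ZMod ℓ)ˣ := ZMod.unitOfCoprime a hcop with hβ
  have hβa : (β : ZMod ℓ) = (a : ZMod ℓ) := by rw [hβ, ZMod.coe_unitOfCoprime]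
  obtain ⟨n, hn⟩ := three_dvd_latticeCoord_shift hK D hopt hadd hirr h3c h9 ha hℓ hℓN h12 hL hy hodd β
  refine ⟨n, ?_⟩
  -- rewrite both classes through `y`
  have h3a : modularSymbol D.f (((3 * a : ℕ) : ℚ) / ℓ) =
      modularSymbol D.f (((((3 * a : ℕ) : ZMod ℓ).val : ℕ) : ℚ) / ℓ) := by
    have := modularSymbol_div_eq_of_intCast D.f hℓ.ne_zero ((3 * a : ℕ) : ℤ)
    rw [Int.cast_natCast] at this
    rw [this]; push_cast; ring_nf
  have h1a : modularSymbol D.f ((a : ℚ) / ℓ) =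
      modularSymbol D.f (((((a : ℕ) : ZMod ℓ).val : ℕ) : ℚ) / ℓ) := by
    have := modularSymbol_div_eq_of_intCast D.f hℓ.ne_zero ((a : ℕ) : ℤ)
    rw [Int.cast_natCast] at this
    rw [this]; push_cast; ring_nf
  rw [h3a, h1a, Complex.sub_im, hy, hy]
  have e3 : ((3 * a : ℕ) : ZMod ℓ) = 3 * (β : ZMod ℓ) := by rw [hβa]; push_cast; ring
  have e1 : ((a : ℕ) : ZMod ℓ) = (β : ZMod ℓ) := hβa.symm
  rw [e3, e1]
  have : ((y (3 * (β : ZMod ℓ)) : ℝ)) - (y (β : ZMod ℓ) : ℝ) = 3 * (n : ℝ) := by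
    have := congrArg (fun z : ℤ ↦ (z : ℝ)) hn
    push_cast at this
    linarith
  calc (y (3 * (β : ZMod ℓ)) : ℝ) * (minusPeriod D.f / 2) - (y (β : ZMod ℓ) : ℝ) * (minusPeriod D.f / 2)
      = (((y (3 * (β : ZMod ℓ)) : ℝ)) - (y (β : ZMod ℓ) : ℝ)) * (minusPeriod D.f / 2) := by ring
    _ = 3 * n * (minusPeriod D.f / 2) := by rw [this]

end Shift

end Summit.BirchSwinnertonDyer.BirchSwinnertonDyer.Theorems.ManinLocalTwoThree

end
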